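/-
Origin: expansion seat `planner-pub-hodgecm-toy-g2-0`, handover #2 2026-08-18T06:19:58Z (`HOME/pub-hodgecm-toy-g2/lean/ToyG2/Isolation.lean`, md5 24cabd9b, 189 lines);
landed by the gen-6 packager in gate run 24 as `HodgeCM/Model/ToyG2/Isolation.lean` (verbatim).
-/
/-
Copyright: HodgeCMPerL referee-model cell (toy lineage, generation 2).  Lean 4 / Mathlib.
-/
import Mathlib
import Summits.HodgeConjecture.HodgeCM.Prior.Perl34_5

/-!
# ToyG2 — the one-line isolation setting (non-vacuity of `Perl34.IsolationSetting`)

`HodgeCM.Universe.ThetaRealisation` (field `S`) asks for a `Perl34.IsolationSetting H HG CG G SK SigIdx SigIdxG`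
— the torus-free core plus the (12) and (34) torus data of [PerL] v5 §3.3 — whose closed subspace
`S.t12.S12 ⊆ HG` receives the (12) products `Λ Γ ω₁ ω₂` (field `gen12`) and whose (34) theta vectors
`S.t34.ϑ χ Φ` are realised by (34) products (field `real34`).

This file shows that the INTERFACE is satisfiable, uniformly in a Hilbert space `HG` and a vector `v : HG`:
`lineSetting v` is an isolation setting with

* `H = ℂ`, `CG = HG`, `G = SK = SigIdx = SigIdxG = Unit`, trivial representation, `𝒯_Φ z = z • v`;
* one character and one test function on each side, `ϑ χ Φ = v`, `E χ f = 1`, `P_w = id`;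
* `S₁₂ = S₃₄ = closure (ℂ ∙ v) = ℂ ∙ v` (`lineSetting_S12`, `lineSetting_S34`).

Every one of the 40-odd axioms (AX5b, AX8, AX9, AX12, H_chars, H_occ, …) then holds by a one-line
computation; in particular the conclusion of `C2_thm37` (`S₁₂ = S₃₄ = S_full`) is visible directly.
This is the `S`-component of the generation-2 programme (DESIGN.md §R0): the eventual theta realisation
uses `lineSetting (Λ Γ ω₃ ω₄)`.

No placeholders, no new axioms; imports `Mathlib` and `HodgeCM.Prior.Perl34` only.
-/

noncomputable section

open scoped InnerProductSpace

namespace HodgeCM.ToyG2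

open HodgeCM.Prior.Perl34File

variable {HG : Type*} [NormedAddCommGroup HG] [InnerProductSpace ℂ HG] [CompleteSpace HG]

/-- The torus-free core on `H = ℂ`, `CG = HG`: trivial group and representation, one Schwartz index,
one isotypic component on each side (`= ⊤`), and theta kernel `𝒯_Φ z = z • v`. -/
def lineCore (v : HG) : Perl34.IsolationCore ℂ HG HG Unit Unit Unit Unit where
  R := 1
  R_unitary := by intro g u w; simp
  omg := fun _ Φ => Φ
  TΦc := fun _ => ContinuousLinearMap.toSpanSingleton ℂ v
  inclCG := ContinuousLinearMap.id ℂ HG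
  hatσ := fun _ => ⊤
  hatσ_closed := fun _ => by simp
  hatσ_invariant := fun _ _ _ _ => Submodule.mem_top
  hatσ_ortho := fun i j h => absurd (Subsingleton.elim i j) h
  hatσ_complete := by
    apply top_le_iff.mp
    exact le_trans (by simp) (Submodule.le_topologicalClosure _)
  eσ := fun _ => ContinuousLinearMap.id ℂ ℂ
  eσ_mem := fun _ _ => Submodule.mem_top
  eσ_fix := fun _ _ _ => rfl
  eσ_selfAdjoint := fun _ _ _ => rfl
  AX9_espectral := fun _ _ _ _ _ hv => hv
  hatτ := fun _ => ⊤
  hatτ_closed := fun _ => by simp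
  hatτ_complete := by
    apply top_le_iff.mp
    exact le_trans (by simp) (Submodule.le_topologicalClosure _)

/-- (Ported verbatim from the HodgeCMPerL package; no docstring in the source.) -/
@[simp] theorem lineCore_R (v : HG) (g : Unit) : (lineCore v).R g = 1 := by
  simp [lineCore]

/-- (Ported verbatim from the HodgeCMPerL package; no docstring in the source.) -/
@[simp] theorem lineCore_TΦ_apply (v : HG) (Φ : Unit) (z : ℂ) :
    (lineCore v).TΦ Φ z = z • v := by
  simp [Perl34.IsolationCore.TΦ, lineCore]

/-- (Ported verbatim from the HodgeCMPerL package; no docstring in the source.) -/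
@[simp] theorem lineCore_inclCG_apply (v : HG) (u : HG) : (lineCore v).inclCG u = u := rfl

/-- (Ported verbatim from the HodgeCMPerL package; no docstring in the source.) -/
@[simp] theorem lineCore_hatσ (v : HG) (i : Unit) : (lineCore v).hatσ i = ⊤ := rfl

/-- The torus data over `lineCore v`: one (allowed) character, one test function, `ϑ χ Φ = v`,
`E χ f = 1 ∈ ℂ`, `S₁₂ := closure (ℂ ∙ v)`, every archimedean type occurs, `P_w = id`. -/
def lineTorus (v : HG) : Perl34.TorusData (lineCore v) where
  X := Unit
  TestFn := Unit
  allowed := fun _ => True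
  ϑc := fun _ _ => v
  E := fun _ _ => 1
  S12 := (ℂ ∙ v).topologicalClosure
  S12_def := by
    congr 1
    apply le_antisymm
    · rw [Submodule.span_le]
      intro u hu
      rw [Set.mem_singleton_iff] at hu
      subst hu
      exact Submodule.subset_span ⟨(), trivial, (), rfl⟩
    · rw [Submodule.span_le]
      rintro u ⟨_, -, _, rfl⟩
      exact Submodule.mem_span_singleton_self _
  wOccurs := fun _ => True
  Pw := ContinuousLinearMap.id ℂ ℂ
  Pw_idem := rfl
  Pw_selfAdjoint := fun _ _ => rfl
  AX5b_ϑ_cont := fun _ => continuous_const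
  AX12_transl_cont := fun _ _ => continuous_const
  ETransl := fun _ _ f => f
  AX12_E_transl := by intro h χ f; simp
  AX12_unfold_lift := by
    intro Φ χ f
    apply Submodule.le_topologicalClosure
    rw [lineCore_TΦ_apply, one_smul]
    exact Submodule.subset_span ⟨(), rfl⟩
  AX12_molly := by
    intro χ Φ
    apply subset_closure
    exact ⟨(), by simp⟩
  AX8_annihilation := by
    intro w hw
    simpa using hw () ()
  AX9_w_vector := by
    intro M _ _ i _ hne
    obtain ⟨x, hx, hx0⟩ := (Submodule.ne_bot_iff _).mp hne
    exact ⟨x, hx, hx0, rfl⟩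

/-- **The one-line isolation setting.** -/
def lineSetting (v : HG) : Perl34.IsolationSetting ℂ HG HG Unit Unit Unit Unit where
  core := lineCore v
  t12 := lineTorus v
  t34 := lineTorus v
  H_chars12 := fun _ => trivial
  H_chars34 := fun _ => trivial
  H_occ12 := fun _ _ _ => trivial
  H_occ34 := fun _ _ _ => trivial

/-- Non-vacuity of the isolation-setting interface of [PerL] v5 §3.3 as transcribed in
`HodgeCM.Prior.Perl34`: for every Hilbert space `HG` (e.g. `ℂ`) it has a model. -/
theorem isolationSetting_nonempty (HG : Type*) [NormedAddCommGroup HG] [InnerProductSpace ℂ HG]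
    [CompleteSpace HG] : Nonempty (Perl34.IsolationSetting ℂ HG HG Unit Unit Unit Unit) :=
  ⟨lineSetting 0⟩

/-! ### The interface of `lineSetting` used by a theta realisation -/

section API

variable (v : HG)

omit [CompleteSpace HG] in
/-- (Ported verbatim from the HodgeCMPerL package; no docstring in the source.) -/
theorem span_singleton_topologicalClosure : (ℂ ∙ v).topologicalClosure = ℂ ∙ v :=
  (Submodule.closed_of_finiteDimensional (ℂ ∙ v)).submodule_topologicalClosure_eq

/-- (Ported verbatim from the HodgeCMPerL package; no docstring in the source.) -/
@[simp] theorem lineSetting_S12 : (lineSetting v).t12.S12 = ℂ ∙ v :=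
  span_singleton_topologicalClosure v

/-- (Ported verbatim from the HodgeCMPerL package; no docstring in the source.) -/
@[simp] theorem lineSetting_S34 : (lineSetting v).t34.S12 = ℂ ∙ v :=
  span_singleton_topologicalClosure v

/-- (Ported verbatim from the HodgeCMPerL package; no docstring in the source.) -/
theorem lineSetting_allowed12 (χ : (lineSetting v).t12.X) : (lineSetting v).t12.allowed χ := trivial

/-- (Ported verbatim from the HodgeCMPerL package; no docstring in the source.) -/
theorem lineSetting_allowed34 (χ : (lineSetting v).t34.X) : (lineSetting v).t34.allowed χ := trivial

/-- (Ported verbatim from the HodgeCMPerL package; no docstring in the source.) -/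
@[simp] theorem lineSetting_ϑ12 (χ : (lineSetting v).t12.X) (Φ : Unit) : (lineSetting v).t12.ϑ χ Φ = v := rfl

/-- (Ported verbatim from the HodgeCMPerL package; no docstring in the source.) -/
@[simp] theorem lineSetting_ϑ34 (χ : (lineSetting v).t34.X) (Φ : Unit) : (lineSetting v).t34.ϑ χ Φ = v := rfl

/-- Membership in `S₁₂` is being a multiple of `v`. -/
theorem mem_lineSetting_S12_iff (u : HG) : u ∈ (lineSetting v).t12.S12 ↔ ∃ c : ℂ, c • v = u := by
  rw [lineSetting_S12, Submodule.mem_span_singleton]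

/-- (Ported verbatim from the HodgeCMPerL package; no docstring in the source.) -/
theorem smul_mem_lineSetting_S12 (c : ℂ) : c • v ∈ (lineSetting v).t12.S12 :=
  (mem_lineSetting_S12_iff v _).mpr ⟨c, rfl⟩

/-- The torus-free space `S_full = closure (Σ_Φ range 𝒯_Φ)` of the one-line setting is the line too —
the conclusion `S₁₂ = S₃₄ = S_full` of `Perl34.IsolationSetting.C2_thm37`, here by inspection. -/
theorem lineSetting_Sfull : (lineSetting v).Sfull = ℂ ∙ v := by
  have h : (⨆ Φ : Unit, LinearMap.range ((lineSetting v).core.TΦ Φ).toLinearMap) = ℂ ∙ v := by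
    apply le_antisymm
    · refine iSup_le fun Φ => ?_
      rintro u ⟨z, rfl⟩
      exact (Submodule.mem_span_singleton).mpr ⟨z, (lineCore_TΦ_apply v Φ z).symm⟩
    · refine le_iSup_of_le () ?_
      rw [Submodule.span_le]
      intro u hu
      rw [Set.mem_singleton_iff] at hu
      subst hu
      exact ⟨1, by simp [lineSetting]⟩
  rw [Perl34.IsolationSetting.Sfull, h, span_singleton_topologicalClosure]

end API

end HodgeCM.ToyG2

end
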